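import Literature.MathematicalPhysics.QuantumFieldTheory.Balaban1983to89.T3FinestHeightTail
import HarnessLib

/-!
# Crux `HistoryTailL` (stmt-QuantumFields-19936), LINE 28 «GrossTransfer», annex 4 §6 `stub_peierls0` — «LEVEL-0 PEIERLS FOR `gibbsK` ON T³»:
# the off-event input (E) of CONSTRUCTION C3 is ALREADY A TREE THEOREM — here in the BOX form the assembly consumes

Cell `ym3-torus` (YM ladder rung R3 = continuum SU(2) Yang–Mills on T³ — a RUNG, NOT Clay: not d = 4, not infinite volume, not a mass gap);
WIDTH helper seat `ym3-torus-px3` g10; `--supports stmt-QuantumFields-19936`; THEOREMS ONLY (0 `def`, 0 `sorry`, default heartbeats); imports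
lit ✓`T3FinestHeightTail` (ym3-torus-lit g8: the Peierls–chessboard single-plaquette tail of the bare `SU(N)` Wilson field on Bałaban's tori,
uniform in the volume, specialised to the cell's `SU(2)` three-torus families).

WHAT THIS FILE PROVES (`F : T3Family`, `γ > 0`, profile `(b₀, p₀)` with `p(g_K) ≥ 0`, cut-off `K` with `β_K = (γε_K)⁻¹ ≥ 1`, threshold
`θ(K) = g_K p(g_K)` = tree `θBal`; the absolute `c ∈ (0, 1]` is the Haar small-ball constant of lit ✓`HaarSmallBallClosedSubgroup`):
* ★ `gibbsK_real_dist1_ge_le` — ONE PLAQUETTE: `Gibbs_K{θ(K) ≤ |U(∂p) − 1|} ≤ 2e^{24}(c³)⁻¹·(√β_K)^9·exp(−p(g_K)²∕4)` (the per-plaquette step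
  inside lit ✓`gibbsK_real_not_plaqSmall_le`, exposed by name);
* ★★ `gibbsK_real_exists_mem_dist1_ge_le` — ANY FINITE SET `X` OF PLAQUETTES (e.g. the plaquettes of a box `Λ` of side `n = 17·L^{j}`,
  `#X = 3n³`): `Gibbs_K{∃ p ∈ X, θ(K) ≤ |U(∂p) − 1|} ≤ #X · 2e^{24}(c³)⁻¹·(√β_K)^9·exp(−p(g_K)²∕4)` (union bound);
* ★★ `gibbsK_real_not_forall_dist1_lt_le` — the same for the complement of the «good event» `G_X = {∀ p ∈ X, |U(∂p) − 1| < θ(K)}`.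
This is annex 4's off-event row «`P(G^c) ≤ 3·17³L^{3j}·(finest-scale one-plaquette large-field bound)`» with the tree's rate `¼` (vs. the
`d = 4` template's `1∕12`) and the polynomial prefactor `(√β_K)^9`: super-polynomially small in `g_K` for Bałaban's profile `p(g) = b₀(1 + log g⁻¹)^{p₀}`,
`p₀ > ½` — no window.  On `G_X` every box bond of the axial-gauge representative is within `(d − 1)·n·θ(K)` of `1` (tree ✓`T4AxialGaugeSmallField`).
HONEST SCOPE.  A repackaging of a landed Literature theorem; level `0` (bare field) only — block-averaged heights `j ≥ 1` are NOT covered; nothing of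
LINE 28's (A2)∕(A3′)∕S_lin∕assembly, `ShallowFluxSecondMomentL`, K1, `MeanDeviationL`, `HistoryTailL` is proved here.  YM₃ on T³ is rung R3,
not Clay; YM gap NOT proved; no summit statement is proved here.

References: T. Bałaban, CMP 102 (1985) 255–275, (7) p. 257, (11) p. 258, (71) p. 273 [Balaban1985UV3]; J. Fröhlich, R. Israel, E. Lieb, B. Simon,
CMP 62 (1978) 1–34, Thm. 4.1 [FrohlichIsraelLiebSimon1978]; L. Gross, CMP 92 (1983) 137–162, Thm. 3.6 [GrossCMP1983].
-/

set_option autoImplicit false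

noncomputable section

open MeasureTheory Set
open scoped BigOperators

namespace Summit.QuantumFields.YangMills.Theorems.UnitScaleGibbsBoxLargeFieldTail

open Literature.MathematicalPhysics.QuantumFieldTheory
open Literature.MathematicalPhysics.QuantumFieldTheory.Balaban1983to89
open Literature.MathematicalPhysics.QuantumFieldTheory.Balaban1983to89.T3ContinuumYM3Torus
open Literature.MathematicalPhysics.QuantumFieldTheory.Balaban1983to89.T3UnitScaleTilt
open Literature.MathematicalPhysics.QuantumFieldTheory.Balaban1983to89.T3UnitLawDensityEML (ℰp)
open Literature.MathematicalPhysics.QuantumFieldTheory.Balaban1983to89.T3CruxEstimates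
open Literature.MathematicalPhysics.QuantumFieldTheory.Balaban1983to89.T3FinestHeightTail

/-- ★ **ONE PLAQUETTE**: there is an absolute `c ∈ (0, 1]` such that for the cell's `SU(2)` three-torus families, every `γ > 0`, every profile
`(b₀, p₀)` with `p(g_K) ≥ 0`, every cut-off `K` with `β_K ≥ 1` and every plaquette `p` of `T^{(0)}_K`:
`Gibbs_K{θ(K) ≤ |U(∂p) − 1|} ≤ 2e^{24}(c³)⁻¹·(√β_K)^9·exp(−p(g_K)²∕4)` (lit ✓`gibbsMeasure_real_dist1_ge_le` with `d = 3`, `N = 2`,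
`β_Kθ(K)² = p(g_K)²`). [cite: Balaban1985UV3, (7) p.257 and (71) p.273; FrohlichIsraelLiebSimon1978, Thm. 4.1] -/
theorem gibbsK_real_dist1_ge_le :
    ∃ c : ℝ, 0 < c ∧ c ≤ 1 ∧ ∀ (F : T3Family) (γ : ℝ), 0 < γ → ∀ (b₀ p₀ : ℝ) (K : ℕ),
      1 ≤ (F.scheme ℰp γ).β K → 0 ≤ B10.pFun b₀ p₀ (Real.sqrt (γ * ((F.L : ℝ)⁻¹) ^ K)) →
        ∀ p : Plaq (F.P K) 0,
          (gibbsK F ℰp γ K).real {U | θBal F.L γ b₀ p₀ K ≤ dist1 (GaugeField.plaqHol U p)} ≤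
            2 * Real.exp 24 * (c ^ 3)⁻¹ * Real.sqrt ((F.scheme ℰp γ).β K) ^ 9 *
              Real.exp (-(B10.pFun b₀ p₀ (Real.sqrt (γ * ((F.L : ℝ)⁻¹) ^ K)) ^ 2 / 4)) := by
  obtain ⟨c, hc, hc1, h⟩ := gibbsMeasure_real_dist1_ge_le (N := 2)
  refine ⟨c, hc, hc1, fun F γ hγ b₀ p₀ K hβ hp p => ?_⟩
  have hθ : 0 ≤ θBal F.L γ b₀ p₀ K := mul_nonneg (Real.sqrt_nonneg _) hp
  have hp1 := h (F.P K) ((F.scheme ℰp γ).β K) hβ (θBal F.L γ b₀ p₀ K) hθ p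
  have hcard2 : Fintype.card {q : Fin (F.P K).d × Fin (F.P K).d // q.1 < q.2} = 3 := by
    rw [show (F.P K).d = 3 from rfl]; decide
  have hd3 : (F.P K).d = 3 := rfl
  rw [gibbsK_eq]
  refine hp1.trans (le_of_eq ?_)
  rw [hcard2, hd3]
  have hexp : (F.scheme ℰp γ).β K * θBal F.L γ b₀ p₀ K ^ 2 / (2 * (2 : ℕ)) =
      B10.pFun b₀ p₀ (Real.sqrt (γ * ((F.L : ℝ)⁻¹) ^ K)) ^ 2 / 4 := by
    rw [beta_mul_θBal_sq F hγ]; norm_num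
  rw [hexp]
  norm_num

/-- ★★ **A BOX (ANY FINITE SET) OF PLAQUETTES — THE OFF-EVENT ROW OF CONSTRUCTION C3**: with the same absolute `c`, for every finite set `X` of
plaquettes of `T^{(0)}_K`: `Gibbs_K{∃ p ∈ X, θ(K) ≤ |U(∂p) − 1|} ≤ #X · 2e^{24}(c³)⁻¹·(√β_K)^9·exp(−p(g_K)²∕4)` (union bound over `X`; for the
box `Λ` of side `n = 17·L^{j}`, `#X = 3n³`). [cite: Balaban1985UV3, (71) p.273; GrossCMP1983, Thm. 3.6 (abelian shape)] -/
theorem gibbsK_real_exists_mem_dist1_ge_le :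
    ∃ c : ℝ, 0 < c ∧ c ≤ 1 ∧ ∀ (F : T3Family) (γ : ℝ), 0 < γ → ∀ (b₀ p₀ : ℝ) (K : ℕ),
      1 ≤ (F.scheme ℰp γ).β K → 0 ≤ B10.pFun b₀ p₀ (Real.sqrt (γ * ((F.L : ℝ)⁻¹) ^ K)) →
        ∀ X : Finset (Plaq (F.P K) 0),
          (gibbsK F ℰp γ K).real {U | ∃ p ∈ X, θBal F.L γ b₀ p₀ K ≤ dist1 (GaugeField.plaqHol U p)} ≤
            X.card * (2 * Real.exp 24 * (c ^ 3)⁻¹ * Real.sqrt ((F.scheme ℰp γ).β K) ^ 9 *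
              Real.exp (-(B10.pFun b₀ p₀ (Real.sqrt (γ * ((F.L : ℝ)⁻¹) ^ K)) ^ 2 / 4))) := by
  obtain ⟨c, hc, hc1, h⟩ := gibbsK_real_dist1_ge_le
  refine ⟨c, hc, hc1, fun F γ hγ b₀ p₀ K hβ hp X => ?_⟩
  have hset : {U : GaugeField (F.P K) 0 (Matrix.specialUnitaryGroup (Fin 2) ℂ) |
      ∃ p ∈ X, θBal F.L γ b₀ p₀ K ≤ dist1 (GaugeField.plaqHol U p)} =
      ⋃ p ∈ X, {U | θBal F.L γ b₀ p₀ K ≤ dist1 (GaugeField.plaqHol U p)} := by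
    ext U; simp only [mem_setOf_eq, mem_iUnion, exists_prop]
  rw [hset]
  refine (measureReal_biUnion_finset_le X _).trans ?_
  calc ∑ p ∈ X, (gibbsK F ℰp γ K).real {U | θBal F.L γ b₀ p₀ K ≤ dist1 (GaugeField.plaqHol U p)}
      ≤ ∑ _p ∈ X, (2 * Real.exp 24 * (c ^ 3)⁻¹ * Real.sqrt ((F.scheme ℰp γ).β K) ^ 9 *
          Real.exp (-(B10.pFun b₀ p₀ (Real.sqrt (γ * ((F.L : ℝ)⁻¹) ^ K)) ^ 2 / 4))) :=
        Finset.sum_le_sum fun p _ => h F γ hγ b₀ p₀ K hβ hp p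
    _ = _ := by rw [Finset.sum_const, nsmul_eq_mul]

/-- ★★ **THE GOOD EVENT `G_X = {∀ p ∈ X, |U(∂p) − 1| < θ(K)}` HAS A SUPER-POLYNOMIALLY SMALL COMPLEMENT**:
`Gibbs_K{¬ ∀ p ∈ X, |U(∂p) − 1| < θ(K)} ≤ #X · 2e^{24}(c³)⁻¹·(√β_K)^9·exp(−p(g_K)²∕4)`.  On `G_X` (for `X` the plaquettes of a box) every box
bond of the axial-gauge representative is within `(d − 1)·n·θ(K)` of `1` (tree ✓`T4AxialGaugeSmallField`), which is what C3's on-event rows use.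
[cite: Balaban1985UV3, (71) p.273] -/
theorem gibbsK_real_not_forall_dist1_lt_le :
    ∃ c : ℝ, 0 < c ∧ c ≤ 1 ∧ ∀ (F : T3Family) (γ : ℝ), 0 < γ → ∀ (b₀ p₀ : ℝ) (K : ℕ),
      1 ≤ (F.scheme ℰp γ).β K → 0 ≤ B10.pFun b₀ p₀ (Real.sqrt (γ * ((F.L : ℝ)⁻¹) ^ K)) →
        ∀ X : Finset (Plaq (F.P K) 0),
          (gibbsK F ℰp γ K).real {U | ¬ ∀ p ∈ X, dist1 (GaugeField.plaqHol U p) < θBal F.L γ b₀ p₀ K} ≤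
            X.card * (2 * Real.exp 24 * (c ^ 3)⁻¹ * Real.sqrt ((F.scheme ℰp γ).β K) ^ 9 *
              Real.exp (-(B10.pFun b₀ p₀ (Real.sqrt (γ * ((F.L : ℝ)⁻¹) ^ K)) ^ 2 / 4))) := by
  obtain ⟨c, hc, hc1, h⟩ := gibbsK_real_exists_mem_dist1_ge_le
  refine ⟨c, hc, hc1, fun F γ hγ b₀ p₀ K hβ hp X => ?_⟩
  have hset : {U : GaugeField (F.P K) 0 (Matrix.specialUnitaryGroup (Fin 2) ℂ) |
      ¬ ∀ p ∈ X, dist1 (GaugeField.plaqHol U p) < θBal F.L γ b₀ p₀ K} =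
      {U | ∃ p ∈ X, θBal F.L γ b₀ p₀ K ≤ dist1 (GaugeField.plaqHol U p)} := by
    ext U; simp only [mem_setOf_eq, not_forall, not_lt, exists_prop]
  rw [hset]
  exact h F γ hγ b₀ p₀ K hβ hp X

end Summit.QuantumFields.YangMills.Theorems.UnitScaleGibbsBoxLargeFieldTail
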